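import Literature.AlgebraicGeometry.Modules.BoxTensorComplexTwoSided
import Literature.AlgebraicGeometry.Modules.StrictlyPerfectResolutionTwist
import Literature.AlgebraicGeometry.AbelianVarieties.MarkmanPhiTilde
import Literature.AlgebraicGeometry.AbelianVarieties.MarkmanKernelTransformDescent
import Literature.AlgebraicGeometry.Motives.AbelianVarietyProductIsogeny
import HarnessLib

/-!
# The box of the `Θ`-twisted pulled-back resolutions: `R₂ := 𝒪(Θ) ⊗ π₁^*R₀₁`, `S₂ := 𝒪(Θ) ⊗ π₂^*R₀₂` and
# `⟨Q(R₂• ⊠ S₂•)⟩ ≅ ([Θ ⊠ Θ] ⊗)⁺(((π₁ × π₂)^*(F₀₁ ⊠ F₀₂))[0])` in `D⁺(Mod 𝒪_{A×A})`, from `Q(R₀₁• ⊠ R₀₂•) ≅ Q((F₀₁ ⊠ F₀₂)[0])`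

Layer `Literature/AlgebraicGeometry/AbelianVarieties`; sequel to `Modules/BoxTensorComplexTwoSided` (chain-level two-sided base change + twists of
`⊠`), `Modules/StrictlyPerfectResolutionTwist` (`twist`) and `MarkmanPhiTilde` (`Θ ⊠ Θ`). For Markman's secant data (`A`, `Θ`, `n ≠ 0`,
`G₁, G₂ ≤ A[n]`, quotient isogenies `πᵢ : A → A∕Gᵢ`) and modules `F₀ᵢ` on `A∕Gᵢ` with strictly perfect resolutions `R₀ᵢ`, this file PROVES
(0 named facts, no instances):

* §1 (generic, `Modules`) **`StrictlyPerfectResolution.pullbackFlat f R`** — the pull-back of a strictly perfect resolution along a FLAT morphism is a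
  strictly perfect resolution of the pulled-back module (`f^*` exact, `Modules/PullbackStalk.preservesHomology_pullback_of_flat`); `pullbackFlat_P` (`rfl`).
* §2 the squares `(π₁ × π₂) ≫ prᵢ = prᵢ ≫ πᵢ` on underlying schemes; **`thetaPullbackResolution A Θ hn hG R₀ := (R₀.pullbackFlat π).twist 𝒪(Θ)`**, a strictly
  perfect resolution of `𝒪(Θ) ⊗ π^*F₀` with complex `𝒪(Θ) ⊗ •π^*•R₀.P` (`thetaPullbackResolution_P`, `rfl`) — the resolutions `R₂`, `S₂` of the cell's
  placement P1 (`G₂ = 𝒪(Θ) ⊗ π₁^*F₀₁`, `H₂ = 𝒪(Θ) ⊗ π₂^*F₀₂`).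
* §3 **`nonempty_thetaPullbackResolutions_box_plusIso`** — GIVEN an isomorphism `eRes : Q(R₀₁• ⊠ R₀₂•) ≅ Q((F₀₁ ⊠ F₀₂)[0])` in `D(Mod 𝒪_{A∕G₁ × A∕G₂})`
  (HYPOTHESIS: «the external product of the resolutions resolves the external product», the Tor-independence of `pr₁^*F₀₁`, `pr₂^*F₀₂` over a field —
  NOT proved in the tree), the isomorphism in `D⁺(Mod 𝒪_{A×A})`
  **`⟨Q(R₂• ⊠ S₂•), h⟩ ≅ ([Θ ⊠ Θ] ⊗)⁺(((π₁ × π₂)^*(F₀₁ ⊠ F₀₂))[0])`**: chain level `R₂• ⊠ S₂• ≅ ([Θ ⊠ Θ] ⊗ –)•((π₁ × π₂)^*•(R₀₁• ⊠ R₀₂•))`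
  (`boxTensorComplexTwoSidedIso`), then `Q` commutes with the two exact functors (`mapDerivedCategoryFactors`; `π₁ × π₂` is a flat isogeny), `eRes`,
  `(π₁ × π₂)^*` of a single complex, and `Plus.ι` fully faithful.

Typed for the cell `pub-hodge-ring2` (crux 26512, placement P1: it feeds `markmanPhiDescentTwist_pullback_vbModel_of_iso` with `X := ⟨Q(R₂• ⊠ S₂•), _⟩`,
the box object of socket v2); a research route conditional on HC_CM, not a corollary — nothing in this file refers to it.

## References

* The Stacks Project, Tag 01CA (Lemma 17.16.4), Tag 0FXX (`K ⊠ M`), Tag 012Z; Tag 08II (Tor independence). [StacksProject]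
* R. Hartshorne, *Algebraic Geometry* (1977), III Prop. 9.2 (flat pull-back exact), III Ex. 6.5. [Hartshorne1977]
* E. Markman, arXiv:2502.03415 (2025), §9.3 p. 70 L35–47 (`E′ := (∪Σᵢ) ⊠ (∪Cᵢ)`, `Φ̃ := Φ ∘ ([Θ ⊠ Θ] ⊗)`). [Markman2025SecantWeil]
* C. A. Weibel, *An introduction to homological algebra* (1994), 10.5.2 (exact functors on `D`). [Weibel1994]
-/

noncomputable section

-- `TopCat.Presheaf`/`Scheme.Modules` are not reducible (as in Mathlib's `AlgebraicGeometry/Modules/Sheaf.lean`).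
set_option backward.isDefEq.respectTransparency false

open CategoryTheory CategoryTheory.Limits AlgebraicGeometry MonoidalCategory CartesianMonoidalCategory
open AlgebraicGeometry.Scheme.Modules

universe v v' u

/-! ### §1 Pull-back of a strictly perfect resolution along a flat morphism -/

namespace Literature.AlgebraicGeometry.Modules

open Literature.AlgebraicGeometry.Motives Literature.AlgebraicGeometry.KTheory

namespace StrictlyPerfectResolution

variable {X Y : Scheme.{u}} (f : X ⟶ Y) [Flat f] {G : Y.Modules}

/-- **Pull-back of a strictly perfect resolution along a FLAT morphism** `f : X ⟶ Y`: `f^*R.P ⟶ f^*G[0] = (f^*G)[0]` is a strictly perfect resolution of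
`f^*G` (pulled-back vector bundles, Stacks 01C8; `f^*` is exact for `f` flat, so it preserves the quasi-isomorphism `ε`).
[cite: Hartshorne1977, III Prop. 9.2 and Ex. 6.5] [cite: StacksProject, Tag 01C8] -/
def pullbackFlat (R : StrictlyPerfectResolution G) : StrictlyPerfectResolution ((Scheme.Modules.pullback f).obj G) :=
  haveI := preservesHomology_pullback_of_flat f
  { P := ((Scheme.Modules.pullback f).mapHomologicalComplex (ComplexShape.up ℤ)).obj R.P
    isBoundedVB := R.isBoundedVB.pullback f
    isStrictlyLE := by
      rw [CochainComplex.isStrictlyLE_iff]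
      intro i hi
      exact (Scheme.Modules.pullback f).map_isZero (R.isZero_X_of_pos hi)
    ε := ((Scheme.Modules.pullback f).mapHomologicalComplex (ComplexShape.up ℤ)).map R.ε ≫
      ((HomologicalComplex.singleMapHomologicalComplex (Scheme.Modules.pullback f) (ComplexShape.up ℤ) 0).app G).hom
    quasiIso := by
      haveI := R.quasiIso
      haveI : IsIso ((HomologicalComplex.singleMapHomologicalComplex (Scheme.Modules.pullback f) (ComplexShape.up ℤ) 0).app G).hom :=
        inferInstance
      exact quasiIso_comp _ _ }

/-- The resolving complex of the flat pull-back is `f^*R.P` termwise (`rfl`). [cite: Hartshorne1977, III Ex. 6.5] -/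
theorem pullbackFlat_P (R : StrictlyPerfectResolution G) :
    (R.pullbackFlat f).P = ((Scheme.Modules.pullback f).mapHomologicalComplex (ComplexShape.up ℤ)).obj R.P := rfl

end StrictlyPerfectResolution

end Literature.AlgebraicGeometry.Modules

namespace Literature.AlgebraicGeometry.AbelianVarieties

open Literature.AlgebraicGeometry.Motives Literature.AlgebraicGeometry.Modules Literature.AlgebraicGeometry.KTheory
open Literature.AlgebraicGeometry.Motives.AbelianVariety

variable (A : AbelianVariety ℂ) (Θ : CartierDivisor A.X.left) {n : ℕ} (hn : n ≠ 0)

/-! ### §2 The squares of `π₁ × π₂` and the resolutions `𝒪(Θ) ⊗ πᵢ^*R₀ᵢ` -/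

section Resolutions

/-- `(π₁ × π₂) ≫ pr₁ = pr₁ ≫ π₁` on underlying schemes. [cite: MumfordAV1970, §19 (homomorphisms into a product)] -/
theorem quotientPairMap_comp_fst (G₁ G₂ : Subgroup (A.Points ℂ)) (hG₁ : G₁ ≤ A.torsionPoints ℂ n) (hG₂ : G₂ ≤ A.torsionPoints ℂ n) :
    quotientPairMap A hn G₁ G₂ hG₁ hG₂ ≫ (fst (A.torsionQuot hn G₁ hG₁).X (A.torsionQuot hn G₂ hG₂).X).left =
      (fst A.X A.X).left ≫ Hom.toSchemeHom (A.torsionQuotHom hn G₁ hG₁) := by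
  exact congrArg Hom.toSchemeHom (prodMap_fst (A.torsionQuotHom hn G₁ hG₁) (A.torsionQuotHom hn G₂ hG₂))

/-- `(π₁ × π₂) ≫ pr₂ = pr₂ ≫ π₂` on underlying schemes. [cite: MumfordAV1970, §19 (homomorphisms into a product)] -/
theorem quotientPairMap_comp_snd (G₁ G₂ : Subgroup (A.Points ℂ)) (hG₁ : G₁ ≤ A.torsionPoints ℂ n) (hG₂ : G₂ ≤ A.torsionPoints ℂ n) :
    quotientPairMap A hn G₁ G₂ hG₁ hG₂ ≫ (snd (A.torsionQuot hn G₁ hG₁).X (A.torsionQuot hn G₂ hG₂).X).left =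
      (snd A.X A.X).left ≫ Hom.toSchemeHom (A.torsionQuotHom hn G₂ hG₂) := by
  exact congrArg Hom.toSchemeHom (prodMap_snd (A.torsionQuotHom hn G₁ hG₁) (A.torsionQuotHom hn G₂ hG₂))

variable {G : Subgroup (A.Points ℂ)} (hG : G ≤ A.torsionPoints ℂ n)

/-- **`𝒪(Θ) ⊗ π^*R₀`** — the `Θ`-twist of the pull-back along the quotient isogeny `π : A → A∕G` of a strictly perfect resolution `R₀` of a module `F₀` on
`A∕G`: a strictly perfect resolution of `𝒪(Θ) ⊗ π^*F₀` (`pullbackFlat` — an isogeny is flat — then `twist` by the rank-one `𝒪(Θ)`). The resolutions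
`R₂`, `S₂` of placement P1 of the cell's `e₂` wiring. [cite: Hartshorne1977, III Prop. 9.2 and Ex. 6.5] [cite: Markman2025SecantWeil, §9.3 p. 70 L35–47] -/
def thetaPullbackResolution {F₀ : (A.torsionQuot hn G hG).X.left.Modules} (R₀ : StrictlyPerfectResolution F₀) :
    StrictlyPerfectResolution (tensorObj (lineBundle Θ.toUnitCocycle)
      ((Scheme.Modules.pullback (Hom.toSchemeHom (A.torsionQuotHom hn G hG))).obj F₀)) :=
  haveI : Flat (Hom.toSchemeHom (A.torsionQuotHom hn G hG)) := flat_toSchemeHom_of_isIsogeny (A.isIsogeny_torsionQuotHom hn G hG)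
  (R₀.pullbackFlat (Hom.toSchemeHom (A.torsionQuotHom hn G hG))).twist Θ.toUnitCocycle.isFiniteLocallyFree_lineBundle
    (isInvertibleModule_of_hasRank_one Θ.toUnitCocycle.isFiniteLocallyFree_lineBundle Θ.toUnitCocycle.hasRank_lineBundle)

/-- The resolving complex of `thetaPullbackResolution` is `𝒪(Θ) ⊗ •π^*•R₀.P` (`rfl`). [cite: Hartshorne1977, III Ex. 6.5] -/
theorem thetaPullbackResolution_P {F₀ : (A.torsionQuot hn G hG).X.left.Modules} (R₀ : StrictlyPerfectResolution F₀) :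
    haveI : ((tensorBifunctor A.X.left).obj (lineBundle Θ.toUnitCocycle)).Additive := additive_tensorBifunctor_obj _
    (thetaPullbackResolution A Θ hn hG R₀).P =
      (((tensorBifunctor A.X.left).obj (lineBundle Θ.toUnitCocycle)).mapHomologicalComplex (ComplexShape.up ℤ)).obj
        (((Scheme.Modules.pullback (Hom.toSchemeHom (A.torsionQuotHom hn G hG))).mapHomologicalComplex (ComplexShape.up ℤ)).obj R₀.P) :=
  rfl

end Resolutions

/-! ### §3 `⟨Q(R₂• ⊠ S₂•)⟩ ≅ ([Θ ⊠ Θ] ⊗)⁺(((π₁ × π₂)^*(F₀₁ ⊠ F₀₂))[0])` from `Q(R₀₁• ⊠ R₀₂•) ≅ Q((F₀₁ ⊠ F₀₂)[0])` -/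

section Box

variable (G₁ G₂ : Subgroup (A.Points ℂ)) (hG₁ : G₁ ≤ A.torsionPoints ℂ n) (hG₂ : G₂ ≤ A.torsionPoints ℂ n)
  [HasDerivedCategory.{v} (A.X ⊗ A.X).left.Modules]
  [HasDerivedCategory.{v'} ((A.torsionQuot hn G₁ hG₁).X ⊗ (A.torsionQuot hn G₂ hG₂).X).left.Modules]

/-- **The chain-level identification** `R₂• ⊠ S₂• ≅ ([Θ ⊠ Θ] ⊗ –)•((π₁ × π₂)^*•(R₀₁• ⊠ R₀₂•))` on `A × A` for `R₂ = 𝒪(Θ) ⊗ π₁^*R₀₁`,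
`S₂ = 𝒪(Θ) ⊗ π₂^*R₀₂` (`Modules/BoxTensorComplexTwoSided.boxTensorComplexTwoSidedIso` at the span map `π₁ × π₂`; `Θ ⊠ Θ = pr₁^*𝒪(Θ) ⊗ pr₂^*𝒪(Θ)` by
definition). [cite: StacksProject, Tag 01CA and Tag 0FXX] [cite: Markman2025SecantWeil, §9.3 p. 70 L47] -/
def thetaPullbackResolutionsBoxIso {F₀₁ : (A.torsionQuot hn G₁ hG₁).X.left.Modules} {F₀₂ : (A.torsionQuot hn G₂ hG₂).X.left.Modules}
    (R₀₁ : StrictlyPerfectResolution F₀₁) (R₀₂ : StrictlyPerfectResolution F₀₂) :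
    haveI : ((tensorBifunctor (A.X ⊗ A.X).left).obj (thetaBox A Θ)).Additive := additive_tensor_thetaBox A (Θ := Θ)
    boxTensorComplex (fst A.X A.X).left (snd A.X A.X).left (thetaPullbackResolution A Θ hn hG₁ R₀₁).P
        (thetaPullbackResolution A Θ hn hG₂ R₀₂).P ≅
      (((tensorBifunctor (A.X ⊗ A.X).left).obj (thetaBox A Θ)).mapHomologicalComplex (ComplexShape.up ℤ)).obj
        (((Scheme.Modules.pullback (quotientPairMap A hn G₁ G₂ hG₁ hG₂)).mapHomologicalComplex (ComplexShape.up ℤ)).obj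
          (boxTensorComplex (fst (A.torsionQuot hn G₁ hG₁).X (A.torsionQuot hn G₂ hG₂).X).left
            (snd (A.torsionQuot hn G₁ hG₁).X (A.torsionQuot hn G₂ hG₂).X).left R₀₁.P R₀₂.P)) :=
  boxTensorComplexTwoSidedIso R₀₁.P R₀₂.P R₀₁.isBoundedVB.isFiniteLocallyFree R₀₂.isBoundedVB.isFiniteLocallyFree
    (quotientPairMap_comp_fst A hn G₁ G₂ hG₁ hG₂) (quotientPairMap_comp_snd A hn G₁ G₂ hG₁ hG₂)
    Θ.toUnitCocycle.isFiniteLocallyFree_lineBundle Θ.toUnitCocycle.isFiniteLocallyFree_lineBundle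

/-- **`⟨Q(R₂• ⊠ S₂•), h⟩ ≅ ([Θ ⊠ Θ] ⊗)⁺(((π₁ × π₂)^*(F₀₁ ⊠ F₀₂))[0])` in `D⁺(Mod 𝒪_{A×A})`**, GIVEN `eRes : Q(R₀₁• ⊠ R₀₂•) ≅ Q((F₀₁ ⊠ F₀₂)[0])` in
`D(Mod 𝒪_{A∕G₁ × A∕G₂})` (hypothesis: the external product of the resolutions resolves the external product — Tor-independence over a field, not
proved here). Proof: `Q` of `thetaPullbackResolutionsBoxIso`, `Q ∘ Φ• ≅ D(Φ) ∘ Q` for the exact `[Θ ⊠ Θ] ⊗ –` and `(π₁ × π₂)^*` (a flat isogeny), `eRes`,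
`(π₁ × π₂)^*•(M[0]) ≅ ((π₁ × π₂)^*M)[0]`, and full faithfulness of `Plus.ι` (`D⁺(Φ)` is `D(Φ)` and `Plus.singleFunctor` is `singleFunctor` under `ι`).
[cite: Weibel1994, 10.5.2] [cite: StacksProject, Tag 0FXX and Tag 08II] [cite: Markman2025SecantWeil, §9.3 p. 70 L35–47] -/
theorem nonempty_thetaPullbackResolutions_box_plusIso {F₀₁ : (A.torsionQuot hn G₁ hG₁).X.left.Modules}
    {F₀₂ : (A.torsionQuot hn G₂ hG₂).X.left.Modules} (R₀₁ : StrictlyPerfectResolution F₀₁) (R₀₂ : StrictlyPerfectResolution F₀₂)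
    (eRes : DerivedCategory.Q.obj (boxTensorComplex (fst (A.torsionQuot hn G₁ hG₁).X (A.torsionQuot hn G₂ hG₂).X).left
        (snd (A.torsionQuot hn G₁ hG₁).X (A.torsionQuot hn G₂ hG₂).X).left R₀₁.P R₀₂.P) ≅
      DerivedCategory.Q.obj ((CochainComplex.singleFunctor _ 0).obj
        (boxTensor (fst (A.torsionQuot hn G₁ hG₁).X (A.torsionQuot hn G₂ hG₂).X).left
          (snd (A.torsionQuot hn G₁ hG₁).X (A.torsionQuot hn G₂ hG₂).X).left F₀₁ F₀₂)))
    (h : DerivedCategory.TStructure.t.plus (DerivedCategory.Q.obj (boxTensorComplex (fst A.X A.X).left (snd A.X A.X).left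
      (thetaPullbackResolution A Θ hn hG₁ R₀₁).P (thetaPullbackResolution A Θ hn hG₂ R₀₂).P))) :
    Nonempty ((⟨_, h⟩ : DerivedCategory.Plus (A.X ⊗ A.X).left.Modules) ≅
      (haveI := additive_tensor_thetaBox A (Θ := Θ)
       haveI := preservesFiniteLimits_tensor_thetaBox A (Θ := Θ)
       haveI := preservesFiniteColimits_tensor_thetaBox A (Θ := Θ)
       ((tensorBifunctor (A.X ⊗ A.X).left).obj (thetaBox A Θ)).mapDerivedCategoryPlus).obj
        ((DerivedCategory.Plus.singleFunctor _ 0).obj ((Scheme.Modules.pullback (quotientPairMap A hn G₁ G₂ hG₁ hG₂)).obj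
          (boxTensor (fst (A.torsionQuot hn G₁ hG₁).X (A.torsionQuot hn G₂ hG₂).X).left
            (snd (A.torsionQuot hn G₁ hG₁).X (A.torsionQuot hn G₂ hG₂).X).left F₀₁ F₀₂)))) := by
  haveI := additive_tensor_thetaBox A (Θ := Θ)
  haveI := preservesFiniteLimits_tensor_thetaBox A (Θ := Θ)
  haveI := preservesFiniteColimits_tensor_thetaBox A (Θ := Θ)
  haveI : Flat (quotientPairMap A hn G₁ G₂ hG₁ hG₂) :=
    flat_toSchemeHom_of_isIsogeny (isIsogeny_prodMap (A.isIsogeny_torsionQuotHom hn G₁ hG₁) (A.isIsogeny_torsionQuotHom hn G₂ hG₂))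
  haveI := preservesFiniteLimits_pullback_of_flat (quotientPairMap A hn G₁ G₂ hG₁ hG₂)
  let T := (tensorBifunctor (A.X ⊗ A.X).left).obj (thetaBox A Θ)
  let π := Scheme.Modules.pullback (quotientPairMap A hn G₁ G₂ hG₁ hG₂)
  let F₀ := boxTensor (fst (A.torsionQuot hn G₁ hG₁).X (A.torsionQuot hn G₂ hG₂).X).left
    (snd (A.torsionQuot hn G₁ hG₁).X (A.torsionQuot hn G₂ hG₂).X).left F₀₁ F₀₂
  let B₀ := boxTensorComplex (fst (A.torsionQuot hn G₁ hG₁).X (A.torsionQuot hn G₂ hG₂).X).left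
    (snd (A.torsionQuot hn G₁ hG₁).X (A.torsionQuot hn G₂ hG₂).X).left R₀₁.P R₀₂.P
  -- in `D(Mod 𝒪_{A×A})`: `Q(R₂ ⊠ S₂) ≅ D(T)(D(π^*)(Q B₀)) ≅ D(T)(D(π^*)(Q F₀[0])) ≅ D(T)(Q((π^*F₀)[0]))`
  let e₁ : DerivedCategory.Q.obj (boxTensorComplex (fst A.X A.X).left (snd A.X A.X).left
      (thetaPullbackResolution A Θ hn hG₁ R₀₁).P (thetaPullbackResolution A Θ hn hG₂ R₀₂).P) ≅
        T.mapDerivedCategory.obj (π.mapDerivedCategory.obj (DerivedCategory.Q.obj B₀)) :=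
    DerivedCategory.Q.mapIso (thetaPullbackResolutionsBoxIso A Θ hn G₁ G₂ hG₁ hG₂ R₀₁ R₀₂) ≪≫
      (T.mapDerivedCategoryFactors.app _).symm ≪≫ T.mapDerivedCategory.mapIso (π.mapDerivedCategoryFactors.app _).symm
  let e₂ : T.mapDerivedCategory.obj (π.mapDerivedCategory.obj (DerivedCategory.Q.obj B₀)) ≅
      T.mapDerivedCategory.obj (DerivedCategory.Q.obj ((CochainComplex.singleFunctor _ 0).obj (π.obj F₀))) :=
    T.mapDerivedCategory.mapIso (π.mapDerivedCategory.mapIso eRes ≪≫ π.mapDerivedCategoryFactors.app _ ≪≫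
      DerivedCategory.Q.mapIso ((HomologicalComplex.singleMapHomologicalComplex π (ComplexShape.up ℤ) 0).app F₀))
  -- under `Plus.ι`: `ι(T⁺ X) = D(T)(ι X)` and `ι(single⁺ M) = single M = Q(M[0])`
  let e₃ : T.mapDerivedCategory.obj (DerivedCategory.Q.obj ((CochainComplex.singleFunctor _ 0).obj (π.obj F₀))) ≅
      DerivedCategory.Plus.ι.obj (T.mapDerivedCategoryPlus.obj ((DerivedCategory.Plus.singleFunctor _ 0).obj (π.obj F₀))) :=
    T.mapDerivedCategory.mapIso (((DerivedCategory.singleFunctorIsoCompQ _ 0).app (π.obj F₀)).symm ≪≫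
        ((DerivedCategory.Plus.singleFunctorιIso _ 0).app (π.obj F₀)).symm) ≪≫
      (T.mapDerivedCategoryPlusCompιIso.app _).symm
  exact ⟨DerivedCategory.Plus.ι.preimageIso (e₁ ≪≫ e₂ ≪≫ e₃)⟩

end Box

end Literature.AlgebraicGeometry.AbelianVarieties

end
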